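import Mathlib
import Summits.Ventures.PercRepro2.IFRTail
import Summits.Ventures.PercRepro2.IFRConv
import Summits.Ventures.PercRepro2.IFRSP

/-!
# Series–parallel networks with arbitrary IFR capacities (seat mine-b, cell pub-perc-repro2)

The capacity form of row B2 (conjectures/MINE-B.md §7.7, "B2-cap"): if the edges of a graph carry
independent integer-valued capacities with log-concave tails (IFR), the s–t max-flow has a log-concave tail.
Bernoulli edges are the special case `edgeTail p`.  For two-terminal series–parallel networks the flow is
again `min` under series and `+` under parallel composition, so the tail calculus of `IFRSP.lean` applies
verbatim with arbitrary log-concave leaf tails: this file records that case (`SPc.tail_logconcave`).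
-/

namespace Summit.Ventures.PercRepro2.IFR

/-- series–parallel networks whose leaves are arbitrary log-concave (IFR) capacity tails -/
inductive SPc : Type
  | leaf (F : ℤ → ℝ) (N : ℤ) (h : IsLCTail F N) : SPc
  | series (a b : SPc) : SPc
  | parallel (a b : SPc) : SPc

/-- a log-concave tail has a positive support bound (`F 0 = 1` but `F N = 0`) -/
theorem IsLCTail.one_le_bound {F : ℤ → ℝ} {N : ℤ} (hF : IsLCTail F N) : 1 ≤ N := by
  by_contra h
  have h1 := hF.one 0 le_rfl
  have h2 := hF.vanish 0 (by omega)
  rw [h1] at h2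
  exact one_ne_zero h2

/-- support bound of the tail calculus -/
def SPc.bound : SPc → ℤ
  | .leaf _ N _ => N
  | .series a b => min a.bound b.bound
  | .parallel a b => a.bound + b.bound

/-- the bound is positive -/
theorem SPc.bound_pos : ∀ t : SPc, 1 ≤ t.bound
  | .leaf _ _ h => h.one_le_bound
  | .series a b => by
      simp only [SPc.bound]; have := SPc.bound_pos a; have := SPc.bound_pos b; omega
  | .parallel a b => by
      simp only [SPc.bound]; have := SPc.bound_pos a; have := SPc.bound_pos b; omega

/-- the tail calculus with arbitrary leaf tails: series ↦ product (minimum), parallel ↦ `Hsum` (sum) -/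
noncomputable def SPc.tail : SPc → (ℤ → ℝ)
  | .leaf F _ _ => F
  | .series a b => fun k => a.tail k * b.tail k
  | .parallel a b => Hsum a.tail b.tail (b.bound + 1)

/-- **B2-cap for series–parallel networks**: the max-flow tail is log-concave for arbitrary independent IFR
capacities on the edges. -/
theorem SPc.tail_isLCTail : ∀ t : SPc, IsLCTail t.tail t.bound
  | .leaf _ _ h => h
  | .series a b => by
      simp only [SPc.tail, SPc.bound]
      exact mul_isLCTail (SPc.tail_isLCTail a) (SPc.tail_isLCTail b)
  | .parallel a b => by
      simp only [SPc.tail, SPc.bound]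
      have hb := SPc.bound_pos b
      exact Hsum_isLCTail (SPc.tail_isLCTail a) (SPc.tail_isLCTail b) le_rfl (by omega)

/-- the headline inequality: `P(F ≥ k−1)·P(F ≥ k+1) ≤ P(F ≥ k)²` for series–parallel networks with IFR capacities -/
theorem SPc.tail_logconcave (t : SPc) (k : ℤ) :
    t.tail (k - 1) * t.tail (k + 1) ≤ t.tail k * t.tail k :=
  (SPc.tail_isLCTail t).lc k

/-- Bernoulli edges embed: `SP` is the special case of `SPc` with leaves `edgeTail p` -/
noncomputable def SP.toSPc : SP → SPc
  | .edge p h0 h1 => .leaf (edgeTail p) 2 (edgeTail_isLCTail h0 h1)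
  | .series a b => .series a.toSPc b.toSPc
  | .parallel a b => .parallel a.toSPc b.toSPc

/-- the embedding preserves bounds -/
theorem SP.toSPc_bound : ∀ t : SP, t.toSPc.bound = t.bound
  | .edge _ _ _ => rfl
  | .series a b => by simp only [SP.toSPc, SPc.bound, SP.bound, SP.toSPc_bound a, SP.toSPc_bound b]
  | .parallel a b => by simp only [SP.toSPc, SPc.bound, SP.bound, SP.toSPc_bound a, SP.toSPc_bound b]

/-- the embedding preserves the tail calculus -/
theorem SP.toSPc_tail : ∀ t : SP, t.toSPc.tail = t.tail
  | .edge _ _ _ => rfl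
  | .series a b => by
      simp only [SP.toSPc, SPc.tail, SP.tail, SP.toSPc_tail a, SP.toSPc_tail b]
  | .parallel a b => by
      simp only [SP.toSPc, SPc.tail, SP.tail, SP.toSPc_tail a, SP.toSPc_tail b, SP.toSPc_bound b]

end Summit.Ventures.PercRepro2.IFR
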